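import Mathlib
import Summits.AtomisticToContinuum.Crystallization.Theorems.SquareWellLayerCakeStackingFaultSparsityExactLatticeLedgerSiteError

/-!
# The exact-lattice ledger of the cylinder block flip (stub `stub_exactLatticeLedger`, line `Sketch`)

Crux `StackingFaultSparsity` (item stmt-AtomisticToContinuum-14296, routes `SquareWellLayerCake` /
`LaminarSixThreeThree`), survey obligation M3c+e of the dilute-faults reshape
(`Cruxes/StackingFaultSparsity/DiluteFaultsSurvey.md`).  On an enumerated EXACT lattice window
`P` (all points of `barlowStacking a h s` within `R` of the block base
`b = barlowPos a h s q₁ i₀ j₀`, `R ≥ ρ + (q₂ - q₁) h + K h + 1`) the changed-pair sum of the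
cylinder flip `latticeShift` (the stacking points of the layers `q₁ < n < q₂` at lateral distance
`≤ ρ` from `b` shifted in-plane by `σ_n • w`, `σ_n = shiftSign s q₁ n`) is at most
`ncol · ∑_{m ∈ [q₁-K, q₂]} (haggLocalEnergyTrunc K J s' m - haggLocalEnergyTrunc K J s m)
 + C_rim ρ (q₂ - q₁ + 2K) + C_T ρ² (q₂ - q₁ + 2K) K⁻³`, `ncol ≥ c_col ρ²`,
`J = barlowCoupling lennardJones a h`, `s'` the flipped word.

## Structure (top down; all proved)

* §1 `ledger_reindex`: the window is parametrised by a finite index set `I ⊆ ℤ³` (`barlowPos` is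
  injective), the displacement becomes `D q` (`σ_{q.1} • w` on the cylinder indices, `0` off them),
  and `changedPairSum = ½ ∑_{q ∈ I} ∑_{q' ∈ I} Δ q q'`, `Δ q q' = V(|new pair|) - V(|old pair|)`.
  `ledger_down_eq_up`: sorting the ordered pairs by the layer gap `d = q'.1 - q.1` into FAR
  `|d| > K`, SAME `d = 0`, UP `1 ≤ d ≤ K`, DOWN `1 ≤ -d ≤ K`, DOWN = UP by symmetry (each changed
  pair is counted ONCE, from its lower layer: survey finding 3, no backward chain energies).
* §2 generic facts of the displaced lattice configuration: rigidly moved pairs do not change, every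
  displacement is `σ • w` with `σ ∈ {0, ±1}`, the displaced configuration is injective and
  `1/2`-separated (refined lattice `ℤu + ℤv + ℤw`, `le_dist_barlowPos_add_zsmul`), vertical gaps
  bound distances below, `|V_LJ(r)| ≤ 6 r⁻⁶` for `r ≥ 1/2`.
* §3 FAR (L5): `ledger_far` (from `ledger_far_site` — per cylinder point the far
  partners contribute `≤ C K⁻³`, `PricedHcpWindowsFarTail.stub_farTail`, proof contributed by the line lead — and the
  cylinder count `card_cyl_le`, `≤ 91 ρ² (q₂ - q₁)`, `MatchedWindowTransfer.card_le_of_lateral_sq_le`).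
* §4 SAME (L4): `ledger_same` (from `ledger_same_site` — a disc point at depth `t`
  sees the non-disc points of its layer only beyond lateral distance `t`, `≤ A max(t-1, 1/2)⁻³` —
  and the depth summation `ledger_depth_sum`, `TriangularLayerCounts.sum_le_of_lateral_depth_bound`).
* §5 UP (L1 + L2 + L3): `ledger_up` (proved from: `ledger_up_zero` — no change below `q₁ - K` or
  above `q₂`; `ledger_up_rim_site` — lower sites OUTSIDE the lateral disc see a cylinder
  point only across the wall; `ledger_up_site_identity` — for a lower site IN the disc of layer `m`
  the UP-sum is `ΔF_K(m)` (bulk identity `blockFlip_sum_layer_tsum_sub` of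
  `Literature/…/BarlowBlockFlipLayers.lean`) plus an explicit window-versus-full-layer remainder;
  `ledger_up_site_error` — that remainder is `≤ A max(depth - 2, 1/2)⁻³` (rim: the moved
  layers are moved only on the disc; truncation: the window misses the points beyond `R`, which are
  `≥ 1 + depth` away); the disc counts `ledger_base_count_ge` (`ncol = #base disc ≥ ρ²/4`),
  `ledger_disc_count_sub_le` (`|n_m - ncol| ≤ 143 ρ`, two layers are lateral translates) and
  `abs_localEnergyTrunc_flip_sub_le` (`|ΔF_K(m)| ≤ J₀` on the box)).
* §6 `stub_exactLatticeLedger` (L6): assembly, `C_rim = C_U + C_S / 2`, `C_T = C_F / 2`.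

Files: `…ExactLatticeLedgerBasics` (§0, §2), `…Reindex` (§1, rim shell sum, depth), `…Far` (§3),
`…Same` (§4, §5a), `…SiteRim` / `…SiteTails` / `…SiteError` (§5b–d), this file (§5e, §6).  Everything
is proved (no `sorry`); the four analytic leaves are all shell sums about ONE site over a
`1/2`-separated partner family (`Literature/…/TwoScaleShellSums.lean`).
-/

noncomputable section
namespace Summit.AtomisticToContinuum.Crystallization.Theorems.SquareWellLayerCake.StackingFaultSparsity
open Literature.MathematicalPhysics.StatisticalMechanics
/-- Euclidean `3`-space. [folklore] -/
local notation "E3" => EuclideanSpace ℝ (Fin 3)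

/-! ## 5e. UP pairs: assembly -/

/-- **No change far below or above the block**: a lower site of a layer `< q₁ - K` or `> q₂` and
its UP-partners (at most `K` layers higher) are all undisplaced. [folklore] -/
theorem ledger_up_zero : ∀ K : ℕ, 2 ≤ K →
    ∀ (a h : ℝ) (s : ℤ → ℤ) (q₁ q₂ i₀ j₀ : ℤ) (ρ R : ℝ) (I : Finset (ℤ × ℤ × ℤ))
      (D : ℤ × ℤ × ℤ → E3) (Δ : ℤ × ℤ × ℤ → ℤ × ℤ × ℤ → ℝ),
      InBox a h → IsHaggSeq s → q₁ < q₂ → (3 : ℤ) ∣ haggLabel s q₂ - haggLabel s q₁ → 1 ≤ ρ →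
      ρ + ((q₂ : ℝ) - q₁) * h + K * h + 1 ≤ R →
      (∀ q, InCyl a h s q₁ q₂ i₀ j₀ ρ q.1 q.2.1 q.2.2 →
        D q = ((shiftSign s q₁ q.1 : ℤ) : ℝ) • barlowOffset a) →
      (∀ q, ¬ InCyl a h s q₁ q₂ i₀ j₀ ρ q.1 q.2.1 q.2.2 → D q = 0) →
      (∀ q q', Δ q q' =
        lennardJones (dist (barlowPos a h s q.1 q.2.1 q.2.2 + D q)
            (barlowPos a h s q'.1 q'.2.1 q'.2.2 + D q')) -
          lennardJones (dist (barlowPos a h s q.1 q.2.1 q.2.2)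
            (barlowPos a h s q'.1 q'.2.1 q'.2.2))) →
      (∀ q, q ∈ I ↔ dist (barlowPos a h s q.1 q.2.1 q.2.2) (barlowPos a h s q₁ i₀ j₀) ≤ R) →
      ∀ q ∈ I, (q.1 < q₁ - K ∨ q₂ < q.1) →
        ∑ q' ∈ I.filter (fun q' => (1 ≤ q'.1 - q.1 ∧ q'.1 - q.1 ≤ K)), Δ q q' = 0 := by
  intro K hK a h s q₁ q₂ i₀ j₀ ρ R I D Δ hbox hs hq hcharge hρ hR hD₁ hD₀ hΔ hI q _ hq'
  refine Finset.sum_eq_zero fun q' hq'' => ?_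
  rw [Finset.mem_filter] at hq''
  refine pairChange_eq_zero_of_disp_eq hΔ ?_
  rw [disp_eq_zero_of_not_mem hD₀ (q := q) (by omega),
    disp_eq_zero_of_not_mem hD₀ (q := q') (by omega)]

/-- **UP pairs** (assembly).  With `ncol = #(base disc)` (`≥ ρ²/4`, `ledger_base_count_ge`) and
`C_U = 143 J₀ + 884 A + C₁`: the lower sites outside the disc give `≤ C₁ ρ (q₂ - q₁)`
(`ledger_up_rim_out`); the lower sites of layers outside `[q₁ - K, q₂]` give `0` (`ledger_up_zero`);
the disc of layer `m ∈ [q₁ - K, q₂]` gives `n_m ΔF_K(m)` (`ledger_up_site_identity`) plus the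
remainders, `≤ 884 A ρ` by `ledger_up_site_error` and `ledger_depth_sum` (`t₀ = 2`), and
`n_m ΔF_K(m) ≤ ncol ΔF_K(m) + 143 ρ J₀`; there are `q₂ - q₁ + K + 1 ≤ q₂ - q₁ + 2K` such layers.
[folklore] -/
theorem ledger_up : ∃ (c_col C_U : ℝ), 0 < c_col ∧ 0 ≤ C_U ∧ ∀ K : ℕ, 2 ≤ K →
    ∀ (a h : ℝ) (s : ℤ → ℤ) (q₁ q₂ i₀ j₀ : ℤ) (ρ R : ℝ) (I : Finset (ℤ × ℤ × ℤ))
      (D : ℤ × ℤ × ℤ → E3) (Δ : ℤ × ℤ × ℤ → ℤ × ℤ × ℤ → ℝ),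
      InBox a h → IsHaggSeq s → q₁ < q₂ → (3 : ℤ) ∣ haggLabel s q₂ - haggLabel s q₁ → 1 ≤ ρ →
      ρ + ((q₂ : ℝ) - q₁) * h + K * h + 1 ≤ R →
      (∀ q, InCyl a h s q₁ q₂ i₀ j₀ ρ q.1 q.2.1 q.2.2 →
        D q = ((shiftSign s q₁ q.1 : ℤ) : ℝ) • barlowOffset a) →
      (∀ q, ¬ InCyl a h s q₁ q₂ i₀ j₀ ρ q.1 q.2.1 q.2.2 → D q = 0) →
      (∀ q q', Δ q q' =
        lennardJones (dist (barlowPos a h s q.1 q.2.1 q.2.2 + D q)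
            (barlowPos a h s q'.1 q'.2.1 q'.2.2 + D q')) -
          lennardJones (dist (barlowPos a h s q.1 q.2.1 q.2.2)
            (barlowPos a h s q'.1 q'.2.1 q'.2.2))) →
      (∀ q, q ∈ I ↔ dist (barlowPos a h s q.1 q.2.1 q.2.2) (barlowPos a h s q₁ i₀ j₀) ≤ R) →
      ∃ ncol : ℕ, c_col * ρ ^ 2 ≤ ncol ∧
        ∑ q ∈ I, ∑ q' ∈ I.filter (fun q' => (1 ≤ q'.1 - q.1 ∧ q'.1 - q.1 ≤ K)), Δ q q' ≤
          ncol * ∑ m ∈ Finset.Icc (q₁ - K) q₂,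
              (haggLocalEnergyTrunc K (barlowCoupling lennardJones a h)
                  (fun n : ℤ => if q₁ ≤ n ∧ n < q₂ then -s n else s n) m -
                haggLocalEnergyTrunc K (barlowCoupling lennardJones a h) s m) +
            C_U * ρ * ((q₂ : ℝ) - q₁ + 2 * K) := by
  obtain ⟨J₀, hJ0, hJ⟩ := abs_localEnergyTrunc_flip_sub_le
  obtain ⟨A, hA0, herr⟩ := ledger_up_site_error
  obtain ⟨C₁, hC10, hrim⟩ := ledger_up_rim_out
  refine ⟨1 / 4, 143 * J₀ + 884 * A + C₁, by norm_num, by positivity, ?_⟩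
  intro K hK a h s q₁ q₂ i₀ j₀ ρ R I D Δ hbox hs hq hcharge hρ hR hD₁ hD₀ hΔ hI
  classical
  have ha : 47 / 50 ≤ a := hbox.1
  have hρ0 : 0 ≤ ρ := by linarith
  set ncol : ℕ := (I.filter (fun q => q.1 = q₁ ∧ (latSq (barlowPos a h s q.1 q.2.1 q.2.2) (barlowPos a h s q₁ i₀ j₀) ≤ ρ ^ 2))).card with hncol
  refine ⟨ncol, ?_, ?_⟩
  · have := ledger_base_count_ge K hK a h s q₁ q₂ i₀ j₀ ρ R I D Δ hbox hs hq hcharge hρ hR hD₁ hD₀ hΔ hI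
    rw [hncol]; linarith
  have hRim := hrim K hK a h s q₁ q₂ i₀ j₀ ρ R I D Δ hbox hs hq hcharge hρ hR hD₁ hD₀ hΔ hI
  have hErr := herr K hK a h s q₁ q₂ i₀ j₀ ρ R I D Δ hbox hs hq hcharge hρ hR hD₁ hD₀ hΔ hI
  have hId := ledger_up_site_identity K hK a h s q₁ q₂ i₀ j₀ ρ R I D Δ hbox hs hq hcharge hρ hR hD₁ hD₀ hΔ hI
  have hZero := ledger_up_zero K hK a h s q₁ q₂ i₀ j₀ ρ R I D Δ hbox hs hq hcharge hρ hR hD₁ hD₀ hΔ hI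
  have hCnt := ledger_disc_count_sub_le K hK a h s q₁ q₂ i₀ j₀ ρ R I D Δ hbox hs hq hcharge hρ hR hD₁ hD₀ hΔ hI
  -- split the lower sites: outside the disc / in the disc
  rw [← Finset.sum_filter_add_sum_filter_not I (fun q => (latSq (barlowPos a h s q.1 q.2.1 q.2.2) (barlowPos a h s q₁ i₀ j₀) ≤ ρ ^ 2))]
  have hOut : ∑ q ∈ I.filter (fun q => ¬ (latSq (barlowPos a h s q.1 q.2.1 q.2.2) (barlowPos a h s q₁ i₀ j₀) ≤ ρ ^ 2)),
      ∑ q' ∈ I.filter (fun q' => (1 ≤ q'.1 - q.1 ∧ q'.1 - q.1 ≤ K)), Δ q q' ≤ C₁ * ρ * ((q₂ : ℝ) - q₁) :=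
    le_trans (Finset.sum_le_sum fun q _ => le_abs_self _) hRim
  -- the disc sites, layer by layer over `[q₁ - K, q₂]`
  have hIn : ∑ q ∈ I.filter (fun q => (latSq (barlowPos a h s q.1 q.2.1 q.2.2) (barlowPos a h s q₁ i₀ j₀) ≤ ρ ^ 2)),
      ∑ q' ∈ I.filter (fun q' => (1 ≤ q'.1 - q.1 ∧ q'.1 - q.1 ≤ K)), Δ q q' =
      ∑ m ∈ Finset.Icc (q₁ - K) q₂,
        ∑ q ∈ (I.filter (fun q => (latSq (barlowPos a h s q.1 q.2.1 q.2.2) (barlowPos a h s q₁ i₀ j₀) ≤ ρ ^ 2) ∧ q.1 ∈ Finset.Icc (q₁ - K) q₂)).filter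
          (fun q => q.1 = m), ∑ q' ∈ I.filter (fun q' => (1 ≤ q'.1 - q.1 ∧ q'.1 - q.1 ≤ K)), Δ q q' := by
    symm
    rw [Finset.sum_fiberwise_of_maps_to (fun q hq' => (Finset.mem_filter.1 hq').2.2)]
    have e1 : I.filter (fun q => (latSq (barlowPos a h s q.1 q.2.1 q.2.2) (barlowPos a h s q₁ i₀ j₀) ≤ ρ ^ 2) ∧ q.1 ∈ Finset.Icc (q₁ - K) q₂) =
        (I.filter (fun q => (latSq (barlowPos a h s q.1 q.2.1 q.2.2) (barlowPos a h s q₁ i₀ j₀) ≤ ρ ^ 2))).filter (fun q => q.1 ∈ Finset.Icc (q₁ - K) q₂) := by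
      ext q
      simp only [Finset.mem_filter, and_assoc]
    rw [e1, Finset.sum_filter (p := fun q : ℤ × ℤ × ℤ => q.1 ∈ Finset.Icc (q₁ - K) q₂)]
    refine Finset.sum_congr rfl fun q hq' => ?_
    split_ifs with hmem
    · rfl
    · rw [Finset.mem_Icc, not_and_or, not_le, not_le] at hmem
      exact (hZero q (Finset.mem_of_mem_filter q hq') (by omega)).symm
  have hLayer : ∀ m ∈ Finset.Icc (q₁ - K) q₂,
      ∑ q ∈ (I.filter (fun q => (latSq (barlowPos a h s q.1 q.2.1 q.2.2) (barlowPos a h s q₁ i₀ j₀) ≤ ρ ^ 2) ∧ q.1 ∈ Finset.Icc (q₁ - K) q₂)).filter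
          (fun q => q.1 = m), ∑ q' ∈ I.filter (fun q' => (1 ≤ q'.1 - q.1 ∧ q'.1 - q.1 ≤ K)), Δ q q' ≤
        (ncol : ℝ) * (haggLocalEnergyTrunc K (barlowCoupling lennardJones a h)
                  (fun n : ℤ => if q₁ ≤ n ∧ n < q₂ then -s n else s n) m -
                haggLocalEnergyTrunc K (barlowCoupling lennardJones a h) s m) + (143 * J₀ + 884 * A) * ρ := by
    intro m hm
    set F := (I.filter (fun q => (latSq (barlowPos a h s q.1 q.2.1 q.2.2) (barlowPos a h s q₁ i₀ j₀) ≤ ρ ^ 2) ∧ q.1 ∈ Finset.Icc (q₁ - K) q₂)).filter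
      (fun q => q.1 = m) with hF
    have hFmem : ∀ q ∈ F, q ∈ I ∧ (latSq (barlowPos a h s q.1 q.2.1 q.2.2) (barlowPos a h s q₁ i₀ j₀) ≤ ρ ^ 2) ∧ q.1 = m := by
      intro q hq'
      simp only [hF, Finset.mem_filter] at hq'
      exact ⟨hq'.1.1, hq'.1.2.1, hq'.2⟩
    have hFeq : F = I.filter (fun q => q.1 = m ∧ (latSq (barlowPos a h s q.1 q.2.1 q.2.2) (barlowPos a h s q₁ i₀ j₀) ≤ ρ ^ 2)) := by
      ext q
      simp only [hF, Finset.mem_filter]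
      constructor
      · rintro ⟨⟨h1, h2, -⟩, h3⟩; exact ⟨h1, h3, h2⟩
      · rintro ⟨h1, h2, h3⟩; exact ⟨⟨h1, h3, by rw [h2]; exact hm⟩, h2⟩
    -- identity + error per site
    have h1 : ∑ q ∈ F, ∑ q' ∈ I.filter (fun q' => (1 ≤ q'.1 - q.1 ∧ q'.1 - q.1 ≤ K)), Δ q q' ≤
        ∑ q ∈ F, ((haggLocalEnergyTrunc K (barlowCoupling lennardJones a h)
                  (fun n : ℤ => if q₁ ≤ n ∧ n < q₂ then -s n else s n) m -
                haggLocalEnergyTrunc K (barlowCoupling lennardJones a h) s m) +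
          A * (max (ρ - √(latSq (barlowPos a h s q.1 q.2.1 q.2.2) (barlowPos a h s q₁ i₀ j₀)) - 2)
            (1 / 2))⁻¹ ^ 3) := by
      refine Finset.sum_le_sum fun q hq' => ?_
      obtain ⟨hqI, hqd, hqm⟩ := hFmem q hq'
      rw [hId m hm q hqI hqm hqd]
      have := hErr m hm q hqI hqm hqd
      linarith [le_abs_self (∑ k ∈ Finset.Icc 1 K,
            ((∑ q' ∈ I.filter (fun q' => q'.1 = m + k),
            lennardJones (dist (barlowPos a h s q.1 q.2.1 q.2.2 + D q)
              (barlowPos a h s q'.1 q'.2.1 q'.2.2 + D q')) -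
          ∑' ij : ℤ × ℤ, lennardJones (dist (barlowPos a h s q.1 q.2.1 q.2.2 + D q)
              (barlowPos a h s (m + k) ij.1 ij.2 +
                (((fun n : ℤ => if q₁ < n ∧ n < q₂ then shiftSign s q₁ n else 0) (m + k) : ℤ) : ℝ) •
                  barlowOffset a))) -
         (∑ q' ∈ I.filter (fun q' => q'.1 = m + k),
            lennardJones (dist (barlowPos a h s q.1 q.2.1 q.2.2) (barlowPos a h s q'.1 q'.2.1 q'.2.2)) -
          ∑' ij : ℤ × ℤ, lennardJones (dist (barlowPos a h s q.1 q.2.1 q.2.2)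
              (barlowPos a h s (m + k) ij.1 ij.2)))))]
    have h2 : ∑ q ∈ F,
        A * (max (ρ - √(latSq (barlowPos a h s q.1 q.2.1 q.2.2) (barlowPos a h s q₁ i₀ j₀)) - 2)
          (1 / 2))⁻¹ ^ 3 ≤ 26 * (8 * 2 + 18) * A * ρ :=
      ledger_depth_sum a h s q₁ i₀ j₀ ρ m 2 A F _ ha hρ (by norm_num) hA0
        (fun q hq' => ⟨(hFmem q hq').2.2, (hFmem q hq').2.1⟩) (fun q _ => le_rfl)
    have h3 : (F.card : ℝ) * (haggLocalEnergyTrunc K (barlowCoupling lennardJones a h)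
                  (fun n : ℤ => if q₁ ≤ n ∧ n < q₂ then -s n else s n) m -
                haggLocalEnergyTrunc K (barlowCoupling lennardJones a h) s m) ≤ (ncol : ℝ) * (haggLocalEnergyTrunc K (barlowCoupling lennardJones a h)
                  (fun n : ℤ => if q₁ ≤ n ∧ n < q₂ then -s n else s n) m -
                haggLocalEnergyTrunc K (barlowCoupling lennardJones a h) s m) + 143 * ρ * J₀ := by
      have hc := hCnt m hm
      rw [← hFeq] at hc
      have hJm := hJ K a h s q₁ q₂ m hbox
      have : ((F.card : ℝ) - ncol) * (haggLocalEnergyTrunc K (barlowCoupling lennardJones a h)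
                  (fun n : ℤ => if q₁ ≤ n ∧ n < q₂ then -s n else s n) m -
                haggLocalEnergyTrunc K (barlowCoupling lennardJones a h) s m) ≤ 143 * ρ * J₀ := by
        refine (le_abs_self _).trans ?_
        rw [abs_mul]
        exact mul_le_mul hc hJm (abs_nonneg _) (by positivity)
      linarith
    rw [Finset.sum_add_distrib, Finset.sum_const, nsmul_eq_mul] at h1
    linarith
  have hcardIcc : ((Finset.Icc (q₁ - K) q₂).card : ℝ) ≤ (q₂ : ℝ) - q₁ + 2 * K := by
    rw [Int.card_Icc]
    have h1 : ((q₂ + 1 - (q₁ - K)).toNat : ℤ) ≤ q₂ - q₁ + 2 * K := by omega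
    have h2 : (((q₂ + 1 - (q₁ - K)).toNat : ℤ) : ℝ) ≤ ((q₂ - q₁ + 2 * K : ℤ) : ℝ) := by exact_mod_cast h1
    push_cast at h2
    exact h2
  have hIn' : ∑ q ∈ I.filter (fun q => (latSq (barlowPos a h s q.1 q.2.1 q.2.2) (barlowPos a h s q₁ i₀ j₀) ≤ ρ ^ 2)),
      ∑ q' ∈ I.filter (fun q' => (1 ≤ q'.1 - q.1 ∧ q'.1 - q.1 ≤ K)), Δ q q' ≤
      (ncol : ℝ) * ∑ m ∈ Finset.Icc (q₁ - K) q₂, (haggLocalEnergyTrunc K (barlowCoupling lennardJones a h)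
                  (fun n : ℤ => if q₁ ≤ n ∧ n < q₂ then -s n else s n) m -
                haggLocalEnergyTrunc K (barlowCoupling lennardJones a h) s m) +
        ((q₂ : ℝ) - q₁ + 2 * K) * ((143 * J₀ + 884 * A) * ρ) := by
    rw [hIn, Finset.mul_sum]
    refine (Finset.sum_le_sum hLayer).trans ?_
    rw [Finset.sum_add_distrib, Finset.sum_const, nsmul_eq_mul]
    have : (0 : ℝ) ≤ (143 * J₀ + 884 * A) * ρ := by positivity
    nlinarith [mul_le_mul_of_nonneg_right hcardIcc this]
  have hq0 : (0 : ℝ) ≤ (q₂ : ℝ) - q₁ := by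
    have : (q₁ : ℝ) < q₂ := by exact_mod_cast hq
    linarith
  have hK0 : (0 : ℝ) ≤ K := Nat.cast_nonneg K
  nlinarith [hIn', hOut, mul_nonneg hC10 hρ0, mul_nonneg (mul_nonneg hC10 hρ0) hK0]

/-! ## 6. Assembly (L6) -/

/-- **Stub `stub_exactLatticeLedger` of line `Sketch`** (crux `StackingFaultSparsity`,
stmt-AtomisticToContinuum-14296; survey obligation M3c+e): the exact-lattice ledger of the cylinder
block flip — `changedPairSum ≤ ncol · (range-K chain change on [q₁ - K, q₂]) + C_rim ρ (q₂ - q₁ + 2K)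
+ C_T ρ² (q₂ - q₁ + 2K) K⁻³`, `ncol ≥ c_col ρ²`.  Assembly of `ledger_reindex`, the FAR / SAME /
UP / DOWN sorting of the ordered pairs, `ledger_far`, `ledger_same`, `ledger_down_eq_up` and
`ledger_up`, with `C_rim = C_U + C_S / 2`, `C_T = C_F / 2`. -/
theorem stub_exactLatticeLedger :
    (∃ (c_col C_rim C_T : ℝ), 0 < c_col ∧ 0 ≤ C_rim ∧ 0 ≤ C_T ∧ ∀ K : ℕ, 2 ≤ K →
      ∀ (a h : ℝ) (s : ℤ → ℤ) (q₁ q₂ i₀ j₀ : ℤ) (ρ R : ℝ) {N' : ℕ} (P : Fin N' → E3),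
        InBox a h → IsHaggSeq s → q₁ < q₂ → (3 : ℤ) ∣ haggLabel s q₂ - haggLabel s q₁ → 1 ≤ ρ →
        ρ + ((q₂ : ℝ) - q₁) * h + K * h + 1 ≤ R →
        Function.Injective P →
        Set.range P = {p ∈ barlowStacking a h s | dist p (barlowPos a h s q₁ i₀ j₀) ≤ R} →
        ∃ ncol : ℕ, c_col * ρ ^ 2 ≤ ncol ∧
          changedPairSum lennardJones P (latticeShift a h s q₁ q₂ i₀ j₀ ρ P) ≤
            ncol * ∑ m ∈ Finset.Icc (q₁ - K) q₂,
                (haggLocalEnergyTrunc K (barlowCoupling lennardJones a h)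
                    (fun n : ℤ => if q₁ ≤ n ∧ n < q₂ then -s n else s n) m -
                  haggLocalEnergyTrunc K (barlowCoupling lennardJones a h) s m) +
              C_rim * ρ * ((q₂ : ℝ) - q₁ + 2 * K) +
              C_T * ρ ^ 2 * ((q₂ : ℝ) - q₁ + 2 * K) * (K : ℝ)⁻¹ ^ 3) := by
  obtain ⟨C_F, hCF0, hFar⟩ := ledger_far
  obtain ⟨C_S, hCS0, hSame⟩ := ledger_same
  obtain ⟨c_col, C_U, hc0, hCU0, hUp⟩ := ledger_up
  refine ⟨c_col, C_U + C_S / 2, C_F / 2, hc0, by positivity, by positivity, ?_⟩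
  intro K hK a h s q₁ q₂ i₀ j₀ ρ R N' P hbox hs hq hcharge hρ hR hP hrange
  classical
  obtain ⟨ha, hh⟩ := InBox.pos hbox
  set D : ℤ × ℤ × ℤ → E3 := fun q => if InCyl a h s q₁ q₂ i₀ j₀ ρ q.1 q.2.1 q.2.2
    then ((shiftSign s q₁ q.1 : ℤ) : ℝ) • barlowOffset a else 0 with hDdef
  have hD₁ : ∀ q, InCyl a h s q₁ q₂ i₀ j₀ ρ q.1 q.2.1 q.2.2 →
      D q = ((shiftSign s q₁ q.1 : ℤ) : ℝ) • barlowOffset a := fun q hq => by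
    simp only [hDdef, if_pos hq]
  have hD₀ : ∀ q, ¬ InCyl a h s q₁ q₂ i₀ j₀ ρ q.1 q.2.1 q.2.2 → D q = 0 := fun q hq => by
    simp only [hDdef, if_neg hq]
  set Δ : ℤ × ℤ × ℤ → ℤ × ℤ × ℤ → ℝ := fun q q' =>
    lennardJones (dist (barlowPos a h s q.1 q.2.1 q.2.2 + D q)
        (barlowPos a h s q'.1 q'.2.1 q'.2.2 + D q')) -
      lennardJones (dist (barlowPos a h s q.1 q.2.1 q.2.2) (barlowPos a h s q'.1 q'.2.1 q'.2.2))
    with hΔdef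
  have hΔ : ∀ q q', Δ q q' =
      lennardJones (dist (barlowPos a h s q.1 q.2.1 q.2.2 + D q)
          (barlowPos a h s q'.1 q'.2.1 q'.2.2 + D q')) -
        lennardJones (dist (barlowPos a h s q.1 q.2.1 q.2.2)
          (barlowPos a h s q'.1 q'.2.1 q'.2.2)) := fun q q' => rfl
  obtain ⟨I, hI, hre⟩ := ledger_reindex a h s q₁ q₂ i₀ j₀ ρ R P D Δ ha hh hD₁ hD₀ hΔ hP hrange
  obtain ⟨ncol, hncol, hU⟩ :=
    hUp K hK a h s q₁ q₂ i₀ j₀ ρ R I D Δ hbox hs hq hcharge hρ hR hD₁ hD₀ hΔ hI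
  have hF := hFar K hK a h s q₁ q₂ i₀ j₀ ρ R I D Δ hbox hs hq hcharge hρ hR hD₁ hD₀ hΔ hI
  have hSm := hSame K hK a h s q₁ q₂ i₀ j₀ ρ R I D Δ hbox hs hq hcharge hρ hR hD₁ hD₀ hΔ hI
  have hsymm : ∀ q q', Δ q q' = Δ q' q := fun q q' => by
    simp only [hΔ, dist_comm]
  have hDU := ledger_down_eq_up K I Δ hsymm
  refine ⟨ncol, hncol, ?_⟩
  rw [hre]
  -- sorting the ordered pairs by the layer gap
  have hpt : ∀ q q' : ℤ × ℤ × ℤ, Δ q q' =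
      (if (K : ℤ) < q'.1 - q.1 ∨ q'.1 - q.1 < -(K : ℤ) then Δ q q' else 0) +
      (if q'.1 = q.1 then Δ q q' else 0) +
      (if 1 ≤ q'.1 - q.1 ∧ q'.1 - q.1 ≤ K then Δ q q' else 0) +
      (if 1 ≤ q.1 - q'.1 ∧ q.1 - q'.1 ≤ K then Δ q q' else 0) := by
    intro q q'
    split_ifs <;> first | (simp only [add_zero, zero_add]; done) | (exfalso; omega)
  have hsplit : ∑ q ∈ I, ∑ q' ∈ I, Δ q q' =
      ∑ q ∈ I, ∑ q' ∈ I.filter (fun q' => (K : ℤ) < q'.1 - q.1 ∨ q'.1 - q.1 < -(K : ℤ)), Δ q q' +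
      ∑ q ∈ I, ∑ q' ∈ I.filter (fun q' => q'.1 = q.1), Δ q q' +
      ∑ q ∈ I, ∑ q' ∈ I.filter (fun q' => 1 ≤ q'.1 - q.1 ∧ q'.1 - q.1 ≤ K), Δ q q' +
      ∑ q ∈ I, ∑ q' ∈ I.filter (fun q' => 1 ≤ q.1 - q'.1 ∧ q.1 - q'.1 ≤ K), Δ q q' := by
    simp only [Finset.sum_filter, ← Finset.sum_add_distrib]
    exact Finset.sum_congr rfl fun q _ => Finset.sum_congr rfl fun q' _ => hpt q q'
  rw [hsplit, hDU]
  -- the three bounds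
  have hF' : ∑ q ∈ I, ∑ q' ∈ I.filter (fun q' => (K : ℤ) < q'.1 - q.1 ∨ q'.1 - q.1 < -(K : ℤ)),
      Δ q q' ≤ C_F * ρ ^ 2 * ((q₂ : ℝ) - q₁) * (K : ℝ)⁻¹ ^ 3 :=
    le_trans (Finset.sum_le_sum fun q _ => Finset.sum_le_sum fun q' _ => le_abs_self _) hF
  have hS' : ∑ q ∈ I, ∑ q' ∈ I.filter (fun q' => q'.1 = q.1), Δ q q' ≤
      C_S * ρ * ((q₂ : ℝ) - q₁) := (le_abs_self _).trans hSm
  have hq' : (0 : ℝ) ≤ (q₂ : ℝ) - q₁ := by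
    have : (q₁ : ℝ) < q₂ := by exact_mod_cast hq
    linarith
  have hK0 : (0 : ℝ) ≤ K := Nat.cast_nonneg K
  have hρ0 : (0 : ℝ) ≤ ρ := by linarith
  have hKi : (0 : ℝ) ≤ (K : ℝ)⁻¹ ^ 3 := by positivity
  have e1 : C_S * ρ * ((q₂ : ℝ) - q₁) ≤ C_S * ρ * ((q₂ : ℝ) - q₁ + 2 * K) := by
    apply mul_le_mul_of_nonneg_left (by linarith) (mul_nonneg hCS0 hρ0)
  have e2 : C_F * ρ ^ 2 * ((q₂ : ℝ) - q₁) * (K : ℝ)⁻¹ ^ 3 ≤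
      C_F * ρ ^ 2 * ((q₂ : ℝ) - q₁ + 2 * K) * (K : ℝ)⁻¹ ^ 3 := by
    apply mul_le_mul_of_nonneg_right _ hKi
    apply mul_le_mul_of_nonneg_left (by linarith) (by positivity)
  nlinarith [hF', hS', hU, e1, e2]

end Summit.AtomisticToContinuum.Crystallization.Theorems.SquareWellLayerCake.StackingFaultSparsity

end
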